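import Summits.QuantumFields.YangMills.Theorems.UnitScaleTiltHalvingHStokesRowOfCombDefect
import Summits.QuantumFields.YangMills.Theorems.UnitScaleTiltHalvingCombTorusTowerOfStep
import Summits.QuantumFields.YangMills.Theorems.UnitScaleTiltHalvingCombTorusPlaquettes
import HarnessLib

/-!
# Line H (`BirthV10.stub_halvingStep`, stmt-QuantumFields-19200) — THE MEMBER-LEVEL (b)-ROW `hStokes`, SHELL: the B-al-3 door ✓`hStokes_of_rows` with its rows `hCU`
# (comb average `U1`-valued), `hcmp` (LEMMA B-al-2 at the member) and `hP` (the comb plaquettes, px3 g5's (R-P)) DISCHARGED BY NAME — only `hG` ((B-al-4)₃) remains displayed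

Cell `ym3-torus` (HUMAN RULING D-0037: YM₃ on T³ is ladder rung R3 — NOT d = 4, NOT infinite volume, NOT a mass gap, NOT the Clay problem), width seat `ym3-torus-px15` gen 4
(LEAD-H ★w5-19200 g7 WORD 22 2026-08-29T05:23:59Z «px15 g4: MEMBER-LEVEL (b)-ROW KNIT `hStokes_holds` — GO; pre-type the shell NOW with `hP hG` as the two remaining hypotheses»).
`--supports stmt-QuantumFields-19200 --as helper`; THEOREMS ONLY (0 `def`, 0 `sorry`); count-neutral; nothing here claims (R-P), (B-al-4), `H42topCrossT`, (M2′), the stub, the crux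
or the gap.

WHAT.  ★★★ `hStokes_holds_of_hG` — ym-ust-20520-w3 g9's ✓`HalvingHStokesRowOfCombDefect.hStokes_of_rows` (conclusion = the assembly's binder (b) VERBATIM, ✓p694481
`HalvingH42TopCrossAssemblyR33.h42topCrossT_of_stokes[_all]`'s `hStokes`) with
* row `hCU` := px3 g5's ✓`HalvingCombTorusTower.avgIter_mem_U1 U′ (pull_toUField_mem …) hε₀ hα3 hα2 (pdev_pull_lt hε₀ hInAk 0) le_rfl` (the comb average is `SU(2) ⊂ U1`-valued),
* row `hcmp` := px15 g4's ✓`HalvingCombTorusTowerOfStep.comb_eq_dbar_mul_defect_inAx` (LEMMA B-al-2 at the member, `hstep` discharged) at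
  **`ρk := 240·(C₂(d) + 40000(d+2)²)·((2dL+1)(d(L−1)+L))²·ε₀²`**, so the door's numeric rows `hρk1`, `hθb` are displayed at that value and B-al-2's scalar windows
  `hα3 hα2 hw1 hw2 hA` join the binders;
* row `hP` := px3 g5's ✓`HalvingCombTorusPlaquettes.plaqSmall_avgIter_of_levels` (the comb top average is `p := 3ε₁ + 44·ρk`-flat on every box, over the PER-LEVEL B-al-2 rows
  ✓`comb_eq_dbar_mul_defect_levels_inAx`) — brings the member's fibre datum `V ε₁ hU hV` and the windows `hε7 hδw hRw hσw` into the binders; `p` is substituted in `hθb`;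
* row `hG` ((B-al-4)₃ effective-gauge row `θG` — ym-ust-20520-w4 g11's `hG_of_rows` ∘ (F-h)(F-hU)(F-ω) ∘ (B-al-4)₄, in flight) DISPLAYED VERBATIM as the one remaining hypothesis.
The full knit `hStokes_holds` (no displayed analytic row) replaces `hG` by that theorem when it lands (sibling file).
HONEST SCOPE.  A by-name composition; nothing analytic here.

References: T. Bałaban, CMP **98** (1985) 17–51 [Balaban1985Averaging] ((42)–(43) pp.23–24, (84) p.30, (89) p.31, (127) p.36); CMP **99** (1985) 75–102
[Balaban1985RegularSpaces] ((1.7) p.77, (1.29) p.81); CMP **109** (1987) 249–301 [Balaban1987RG1] ((0.4) p.253).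
-/

set_option autoImplicit false

noncomputable section

open scoped BigOperators Matrix.Norms.L2Operator
open NormedSpace
open Complex (I)

namespace Summit.QuantumFields.YangMills.Theorems.HalvingHStokesRowShell

open Literature.MathematicalPhysics.QuantumFieldTheory.Balaban1983to89
open Literature.MathematicalPhysics.QuantumFieldTheory.Balaban1983to89.T3ContinuumYM3Torus
open B5Eq118OneStroke (iterBlockOf)
open B7Prop1Explicit (e U1)
open B7Prop1Explicit renaming Site → LSite
open B7Prop2Explicit (unitaryUnits C0 c2' avgIter)
open B7Prop4Flat (C2 c4 C1_pos)
open B7Prop1Local (InBox loK bondHiK)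
open B7Eq92Concrete (mgauge)
open B7Eq84Concrete (uavg)
open B8Ineq130 (tlo thi)
open B8Ineq132 (covDerivFwd InAk)
open B8Eq119TwistedAxial (Restr129 InAx)
open B8Eq131Cubes (cube gs tLo tHi)
open B8Eq131CubesAdmissible (cubeFam)
open B8CubeMemberZd (cubeLamS)
open B8Eq184Proof (gaugeExp cfgExp)
open B8Eq140Level (SideTouches)
open B8Eq138LandauZd (IsLandau138W)
open B8LambdaSpaceKLevel (wt)
open B8Lemma1NonAbelian (lowPart)
open B9SupplySockB9P3ZdGamma (cubeLamBP')
open B10Eq27TorusAxialLog (rel pull unitsField toUField suIncl gaugeActT axialT)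
open B15Eq112TorusCover (lift cover)
open Node00 (coverAt)
open Summit.QuantumFields.YangMills.Theorems.Prop8ChartDoubleBar (dbarIterU vframeU)
open Summit.QuantumFields.YangMills.Theorems.Prop7AxialReprPrint (pull_toUField_mem pdev_pull_lt)
open HalvingHStokesRowOfCombDefect (hStokes_of_rows)
open HalvingCombTorusTower (avgIter_mem_U1)
open HalvingCombTorusTowerOfStep (comb_eq_dbar_mul_defect_inAx comb_eq_dbar_mul_defect_levels_inAx)
open HalvingCombTorusPlaquettes (plaqSmall_avgIter_of_levels)
open Literature.MathematicalPhysics.QuantumFieldTheory.Balaban1983to89.T3PrintedRegularMinimiser (regFibrePr)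

variable (F : T3Family) {n K : ℕ}

/-- ★★★ **THE (b)-ROW AT THE MEMBER, SHELL**: ✓`hStokes_of_rows` with `hCU`, `hcmp` (= LEMMA B-al-2, `ρk := 240·c₁·δc²·ε₀²`) and `hP` (= (R-P), `p := 3ε₁ + 44ρk`) discharged by
name; the effective-gauge row `hG` remains displayed; the conclusion is the assembly's binder (b) VERBATIM.
[cite: Balaban1985Averaging, (42)-(43) pp.23-24, (84) p.30, (89) p.31, (92) p.31, (127) p.36; Balaban1985RegularSpaces, (1.7) p.77, (1.29) p.81; Balaban1987RG1, (0.4) p.253] -/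
theorem hStokes_holds_of_hG (hnK : n < K) (x₀ : Site (F.P K) 0) {a : LSite (F.P K).d} {M' ρ' : ℕ} (hM' : 1 ≤ M')
    (ha : ∀ ν, a ν ≤ ((iterBlockOf (K - n) x₀ ν).val : ℤ) ∧ ((iterBlockOf (K - n) x₀ ν).val : ℤ) ≤ a ν + M' - 1)
    (hroomW : 2 * ((F.P K).L ^ (K - n) * (M' + 1) + ρ' * gs (F.P K).L (K - n)) ≤ (F.P K).sitesPerDir 0)
    (U : GaugeField (F.P K) 0 (Matrix.specialUnitaryGroup (Fin 2) ℂ))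
    {ε₀ s α₄ θb θG ε₁ : ℝ} (hε₀ : 0 < ε₀) (hθG0 : 0 ≤ θG)
    -- the member's fibre datum (px3 g5's (R-P) ✓`HalvingCombTorusPlaquettes.plaqSmall_avgIter_of_levels`): `U ∈ 𝔘_k(ε₀) ∩ fibre(V)`, `V` `ε₁`-small, `10⁷L³ε₀ ≤ 1`
    (V : GaugeField (F.P n) 0 (Matrix.specialUnitaryGroup (Fin 2) ℂ)) (hU : U ∈ regFibrePr F n K hnK.le ε₀ V) (hε₁ : 0 ≤ ε₁) (hε₁1 : ε₁ ≤ 1) (hV : PlaqSmall ε₁ V)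
    (hε7 : 10 ^ 7 * (F.L : ℝ) ^ 3 * ε₀ ≤ 1)
    (hδw : (((2 * ((F.P K).d * (F.P K).L) + 1) * ((F.P K).d * ((F.P K).L - 1) + (F.P K).L) : ℕ) : ℝ) * (4 * ε₀) ≤ 1 / 200)
    (hRw : (240 * (C2 (F.P K).d + 40000 * (((F.P K).d : ℝ) + 2) ^ 2) *
        (((2 * ((F.P K).d * (F.P K).L) + 1) * ((F.P K).d * ((F.P K).L - 1) + (F.P K).L) : ℕ) : ℝ) ^ 2 * ε₀ ^ 2) ≤ 1 / 200)
    (hσw : 600 * ((((F.P K).d + 2) * (F.P K).L : ℕ) : ℝ) * ((((2 * ((F.P K).d * (F.P K).L) + 1) * ((F.P K).d * ((F.P K).L - 1) + (F.P K).L) : ℕ) : ℝ) * (4 * ε₀) +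
      102 / 100 * (240 * (C2 (F.P K).d + 40000 * (((F.P K).d : ℝ) + 2) ^ 2) *
        (((2 * ((F.P K).d * (F.P K).L) + 1) * ((F.P K).d * ((F.P K).L - 1) + (F.P K).L) : ℕ) : ℝ) ^ 2 * ε₀ ^ 2)) ≤ 1)
    -- the scalar windows of LEMMA B-al-2 (✓`HalvingCombTorusTowerOfStep.comb_eq_dbar_mul_defect_inAx`: Prop. 2, (B-iv) at the top level, `33A ≤ 20L⁴`)
    (hα3 : C0 (F.P K).d * (2 * ε₀) ≤ 1 / 3) (hα2 : 2 * (2 * ε₀) ≤ c2' (F.P K).d (F.P K).L)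
    (hw1 : 10 ^ 4 * ((((F.P K).d + 2) * (F.P K).L : ℕ) : ℝ) *
      ((((2 * ((F.P K).d * (F.P K).L) + 1) * ((F.P K).d * ((F.P K).L - 1) + (F.P K).L) : ℕ) : ℝ) * (4 * ε₀) +
        2 * (240 * (C2 (F.P K).d + 40000 * (((F.P K).d : ℝ) + 2) ^ 2) *
          (((2 * ((F.P K).d * (F.P K).L) + 1) * ((F.P K).d * ((F.P K).L - 1) + (F.P K).L) : ℕ) : ℝ) ^ 2 * ε₀ ^ 2)) ≤ 1)
    (hw2 : ((F.P K).L : ℝ) * (2 * ((((2 * ((F.P K).d * (F.P K).L) + 1) * ((F.P K).d * ((F.P K).L - 1) + (F.P K).L) : ℕ) : ℝ) * (4 * ε₀))) ≤ c4 (F.P K).d)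
    (hA : 33 * (2 * (((((F.P K).d + 2) * (F.P K).L : ℕ) : ℝ) + (F.P K).L + 2 * (((F.P K).d * (((F.P K).L - 1) / 2) : ℕ) : ℝ))) ≤ 20 * ((F.P K).L : ℝ) ^ 4)
    -- the door's numeric rows at the B-al-2 constant `240·c₁·δc²·ε₀²`
    (hρk1 : ((F.P K).d : ℝ) * (M' + ρ') * (240 * (C2 (F.P K).d + 40000 * (((F.P K).d : ℝ) + 2) ^ 2) *
        (((2 * ((F.P K).d * (F.P K).L) + 1) * ((F.P K).d * ((F.P K).L - 1) + (F.P K).L) : ℕ) : ℝ) ^ 2 * ε₀ ^ 2) ≤ 1 / 8) (hθG1 : θG ≤ 1 / 8)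
    (hθb : 2 * (((F.P K).d : ℝ) * (M' + ρ') * ((F.P K).d * ((M' : ℝ) - 1 + 4 * ρ') * (3 * ε₁ + 44 * (240 * (C2 (F.P K).d + 40000 * (((F.P K).d : ℝ) + 2) ^ 2) *
        (((2 * ((F.P K).d * (F.P K).L) + 1) * ((F.P K).d * ((F.P K).L - 1) + (F.P K).L) : ℕ) : ℝ) ^ 2 * ε₀ ^ 2)) + 4 * (240 * (C2 (F.P K).d + 40000 * (((F.P K).d : ℝ) + 2) ^ 2) *
        (((2 * ((F.P K).d * (F.P K).L) + 1) * ((F.P K).d * ((F.P K).L - 1) + (F.P K).L) : ℕ) : ℝ) ^ 2 * ε₀ ^ 2))) + 3 * θG ≤ θb)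
    -- ROW (R-G): (B-al-4) — under the binder's own field∕datum guards (InAk, InAx, tower, top-axial, SU(2), (R1) `mgauge 1 u₁ W = U′`, chart rows, (R2) Restr129),
    -- the effective gauge of `u₁⁻¹` down `X̂`'s double-bar tower is within `θG` of `1` at the base block and on the top cube
    (hG : ∀ (gJ : GaugeTransf (F.P K) 0 (Matrix.specialUnitaryGroup (Fin 2) ℂ)) (u₁ : LSite (F.P K).d → (Matrix (Fin 2) (Fin 2) ℂ)ˣ)
        (W : LSite (F.P K).d → Fin (F.P K).d → (Matrix (Fin 2) (Fin 2) ℂ)ˣ) (A : LSite (F.P K).d → Fin (F.P K).d → Matrix (Fin 2) (Fin 2) ℂ) (c₁ c' : ℝ),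
      InAk (F.P K).L (K - n) (((F.L : ℝ)⁻¹) ^ (K - n)) ε₀ (fun _ => (Set.univ : Set (LSite (F.P K).d))) (pull (unitsField (toUField (GaugeField.gaugeAct gJ U))) 0) →
      (∀ m', m' ≤ K - n → ∀ Λ : ℕ → Set (LSite (F.P K).d), InAx (F.P K).L m' Λ (1 : LSite (F.P K).d → Fin (F.P K).d → (Matrix (Fin 2) (Fin 2) ℂ)ˣ) (pull (unitsField (toUField (GaugeField.gaugeAct gJ U))) 0)) →
      (∀ m', m' ≤ K - n → ∀ (x : LSite (F.P K).d) (ν : Fin (F.P K).d), tlo (F.P K).L (tLo a ρ') m' ≤ x → x + e ν ≤ thi (F.P K).L (tHi a M' ρ') m' →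
        ‖((avgIter (F.P K).L (pull (unitsField (toUField (GaugeField.gaugeAct gJ U))) 0) (K - n - m') x ν : (Matrix (Fin 2) (Fin 2) ℂ)ˣ) : Matrix (Fin 2) (Fin 2) ℂ) - 1‖ < s) →
      (∀ (x : LSite (F.P K).d) (ν : Fin (F.P K).d), tLo a ρ' ≤ x → x + e ν ≤ tHi a M' ρ' → lowPart ν (x - tLo a ρ') = 0 →
        avgIter (F.P K).L (pull (unitsField (toUField (GaugeField.gaugeAct gJ U))) 0) (K - n) x ν = 1) →
      (∀ z, ((u₁ z : (Matrix (Fin 2) (Fin 2) ℂ)ˣ) : Matrix (Fin 2) (Fin 2) ℂ) ∈ Matrix.specialUnitaryGroup (Fin 2) ℂ) →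
      mgauge (1 : LSite (F.P K).d → Fin (F.P K).d → (Matrix (Fin 2) (Fin 2) ℂ)ˣ) u₁ W = pull (unitsField (toUField (GaugeField.gaugeAct gJ U))) 0 →
      0 ≤ c' → 8 * 3800 * ((((F.P K).d + 2) * (F.P K).L : ℕ) : ℝ) ^ 2 * c' ≤ 1 → Real.exp c₁ - 1 ≤ ((F.L : ℝ)⁻¹) ^ (K - n) * c' →
      (∀ z ∈ cube (F.P K).L a M' ρ' (K - n) (K - n), ∀ ν : Fin (F.P K).d, W z ν = cfgExp (((F.L : ℝ)⁻¹) ^ (K - n)) A z ν ∧ ((F.L : ℝ)⁻¹) ^ (K - n) * ‖A z ν‖ ≤ c₁) →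
      Restr129 (F.P K).L (K - n) (cubeLamS (F.P K).L a M' ρ' (K - n) (K - n)) (1 : LSite (F.P K).d → Fin (F.P K).d → (Matrix (Fin 2) (Fin 2) ℂ)ˣ) u₁ →
      ∀ (κ : (i : ℕ) → GaugeTransf (F.P K) i (Matrix (Fin 2) (Fin 2) ℂ)ˣ),
        (κ 0 = fun s => (u₁ (lift (F.P K) x₀ + rel x₀ s))⁻¹) →
        (∀ (i : ℕ) (y : Site (F.P K) (i + 1)),
          κ (i + 1) y = (vframeU (gaugeActT (κ i) (dbarIterU i (unitsField (toUField (GaugeField.gaugeAct gJ U))))) y)⁻¹ * κ i (emb y) * vframeU (dbarIterU i (unitsField (toUField (GaugeField.gaugeAct gJ U)))) y) →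
        ‖((κ (K - n) (iterBlockOf (K - n) x₀) : (Matrix (Fin 2) (Fin 2) ℂ)ˣ) : (Matrix (Fin 2) (Fin 2) ℂ)) - 1‖ ≤ θG ∧
        ∀ yc ∈ cubeLamS (F.P K).L a M' ρ' (K - n) (K - n) (K - n), ‖((κ (K - n) (coverAt (F.P K) (K - n) yc) : (Matrix (Fin 2) (Fin 2) ℂ)ˣ) : (Matrix (Fin 2) (Fin 2) ℂ)) - 1‖ ≤ θG) :
        ∀ (gJ : GaugeTransf (F.P K) 0 (Matrix.specialUnitaryGroup (Fin 2) ℂ)) (u₁ : LSite (F.P K).d → (Matrix (Fin 2) (Fin 2) ℂ)ˣ)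
        (W : LSite (F.P K).d → Fin (F.P K).d → (Matrix (Fin 2) (Fin 2) ℂ)ˣ) (A : LSite (F.P K).d → Fin (F.P K).d → Matrix (Fin 2) (Fin 2) ℂ) (c₁ c' : ℝ)
        (κf : (Site (F.P K) 0 → Matrix (Fin 2) (Fin 2) ℂ) → (i : ℕ) → GaugeTransf (F.P K) i (Matrix (Fin 2) (Fin 2) ℂ)ˣ) (lam : LSite (F.P K).d → Matrix (Fin 2) (Fin 2) ℂ),
      InAk (F.P K).L (K - n) (((F.L : ℝ)⁻¹) ^ (K - n)) ε₀ (fun _ => (Set.univ : Set (LSite (F.P K).d))) (pull (unitsField (toUField (GaugeField.gaugeAct gJ U))) 0) →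
      (∀ m', m' ≤ K - n → ∀ Λ : ℕ → Set (LSite (F.P K).d), InAx (F.P K).L m' Λ (1 : LSite (F.P K).d → Fin (F.P K).d → (Matrix (Fin 2) (Fin 2) ℂ)ˣ) (pull (unitsField (toUField (GaugeField.gaugeAct gJ U))) 0)) →
      (∀ m', m' ≤ K - n → ∀ (x : LSite (F.P K).d) (ν : Fin (F.P K).d), tlo (F.P K).L (tLo a ρ') m' ≤ x → x + e ν ≤ thi (F.P K).L (tHi a M' ρ') m' →
        ‖((avgIter (F.P K).L (pull (unitsField (toUField (GaugeField.gaugeAct gJ U))) 0) (K - n - m') x ν : (Matrix (Fin 2) (Fin 2) ℂ)ˣ) : Matrix (Fin 2) (Fin 2) ℂ) - 1‖ < s) →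
      (∀ (x : LSite (F.P K).d) (ν : Fin (F.P K).d), tLo a ρ' ≤ x → x + e ν ≤ tHi a M' ρ' → lowPart ν (x - tLo a ρ') = 0 →
        avgIter (F.P K).L (pull (unitsField (toUField (GaugeField.gaugeAct gJ U))) 0) (K - n) x ν = 1) →
      (∀ z, ((u₁ z : (Matrix (Fin 2) (Fin 2) ℂ)ˣ) : Matrix (Fin 2) (Fin 2) ℂ) ∈ Matrix.specialUnitaryGroup (Fin 2) ℂ) →
      mgauge (1 : LSite (F.P K).d → Fin (F.P K).d → (Matrix (Fin 2) (Fin 2) ℂ)ˣ) u₁ W = pull (unitsField (toUField (GaugeField.gaugeAct gJ U))) 0 →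
      0 ≤ c' → 8 * 3800 * ((((F.P K).d + 2) * (F.P K).L : ℕ) : ℝ) ^ 2 * c' ≤ 1 → Real.exp c₁ - 1 ≤ ((F.L : ℝ)⁻¹) ^ (K - n) * c' →
      (∀ z ∈ cube (F.P K).L a M' ρ' (K - n) (K - n), ∀ ν : Fin (F.P K).d, W z ν = cfgExp (((F.L : ℝ)⁻¹) ^ (K - n)) A z ν ∧ ((F.L : ℝ)⁻¹) ^ (K - n) * ‖A z ν‖ ≤ c₁) →
      (∀ (m : Site (F.P K) 0 → Matrix (Fin 2) (Fin 2) ℂ) (i : ℕ) (y : Site (F.P K) (i + 1)), κf m (i + 1) y = (vframeU (gaugeActT (κf m i) (dbarIterU i (gaugeActT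
          (fun s => (u₁ (lift (F.P K) x₀ + rel x₀ s))⁻¹ * Unitary.toUnits (suIncl (gJ s)) : GaugeTransf (F.P K) 0 (Matrix (Fin 2) (Fin 2) ℂ)ˣ)
          (unitsField (toUField U))))) y)⁻¹ * κf m i (emb y) * vframeU (dbarIterU i (gaugeActT
            (fun s => (u₁ (lift (F.P K) x₀ + rel x₀ s))⁻¹ * Unitary.toUnits (suIncl (gJ s)) : GaugeTransf (F.P K) 0 (Matrix (Fin 2) (Fin 2) ℂ)ˣ) (unitsField (toUField U)))) y) →
      (∀ (m : Site (F.P K) 0 → Matrix (Fin 2) (Fin 2) ℂ) (x : Site (F.P K) 0), ((κf m 0 x : (Matrix (Fin 2) (Fin 2) ℂ)ˣ) : Matrix (Fin 2) (Fin 2) ℂ) = exp (m x)) →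
      (∀ x, IsSelfAdjoint (lam x)) → (∀ x, (lam x).trace = 0) → (∀ yc ∈ cubeLamS (F.P K).L a M' ρ' (K - n) (K - n) (K - n),
        κf (((-I) • lam) ∘ fun s : Site (F.P K) 0 => lift (F.P K) x₀ + rel x₀ s) (K - n) (coverAt (F.P K) (K - n) yc) = axialT (dbarIterU (K - n) (gaugeActT
            (fun s => (u₁ (lift (F.P K) x₀ + rel x₀ s))⁻¹ * Unitary.toUnits (suIncl (gJ s)) : GaugeTransf (F.P K) 0 (Matrix (Fin 2) (Fin 2) ℂ)ˣ)
            (unitsField (toUField U)))) (iterBlockOf (K - n) x₀) (coverAt (F.P K) (K - n) yc)) →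
      (∀ j, j ≤ K - n → ∀ b ∈ {b : LSite (F.P K).d × Fin (F.P K).d | SideTouches ((cubeFam false (F.P K).L a M' ρ' (K - n)) j) b.1 b.2},
        ‖lam b.1‖ ≤ α₄ ∧ wt (F.P K).L (((F.L : ℝ)⁻¹) ^ (K - n)) j * ‖covDerivFwd (((F.L : ℝ)⁻¹) ^ (K - n)) (1 : LSite (F.P K).d → Fin (F.P K).d → (Matrix (Fin 2) (Fin 2) ℂ)ˣ) b.2 lam b.1‖ ≤ α₄) →
      Restr129 (F.P K).L (K - n) (cubeLamS (F.P K).L a M' ρ' (K - n) (K - n)) (1 : LSite (F.P K).d → Fin (F.P K).d → (Matrix (Fin 2) (Fin 2) ℂ)ˣ) u₁ →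
      Restr129 (F.P K).L (K - n) (Function.update (cubeLamS (F.P K).L a M' ρ' (K - n) (K - n)) (K - n) ∅) (1 : LSite (F.P K).d → Fin (F.P K).d → (Matrix (Fin 2) (Fin 2) ℂ)ˣ) (u₁ * gaugeExp lam) →
      ∀ yc ∈ cubeLamS (F.P K).L a M' ρ' (K - n) (K - n) (K - n),
        ‖((axialT (dbarIterU (K - n) (gaugeActT
            (fun s => (u₁ (lift (F.P K) x₀ + rel x₀ s))⁻¹ * Unitary.toUnits (suIncl (gJ s)) : GaugeTransf (F.P K) 0 (Matrix (Fin 2) (Fin 2) ℂ)ˣ)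
            (unitsField (toUField U)))) (iterBlockOf (K - n) x₀) (coverAt (F.P K) (K - n) yc) : (Matrix (Fin 2) (Fin 2) ℂ)ˣ) : Matrix (Fin 2) (Fin 2) ℂ) - 1‖ ≤ θb :=
  hStokes_of_rows F x₀ hM' ha hroomW U (p := 3 * ε₁ + 44 * (240 * (C2 (F.P K).d + 40000 * (((F.P K).d : ℝ) + 2) ^ 2) * (((2 * ((F.P K).d * (F.P K).L) + 1) * ((F.P K).d * ((F.P K).L - 1) + (F.P K).L) : ℕ) : ℝ) ^ 2 * ε₀ ^ 2))
    (by have := C1_pos (F.P K).d; unfold C2; positivity) (by have := C1_pos (F.P K).d; unfold C2; positivity) hθG0 hρk1 hθG1 hθb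
    (fun gJ hInAk _ z ν => avgIter_mem_U1 _ (pull_toUField_mem (GaugeField.gaugeAct gJ U) 0) hε₀ hα3 hα2 (pdev_pull_lt hε₀ hInAk 0) le_rfl z ν)
    (fun gJ hInAk hInAx z ν => comb_eq_dbar_mul_defect_inAx F hnK hε₀ hα3 hα2 hw1 hw2 hA U gJ hInAk hInAx z ν)
    (fun gJ hInAk hInAx => plaqSmall_avgIter_of_levels F hnK hε₀ hε7 hε₁ hε₁1 (by have := C1_pos (F.P K).d; unfold C2; positivity) V U hU hV gJ hInAk hInAx hα3 hα2
      (comb_eq_dbar_mul_defect_levels_inAx F hnK hε₀ hα3 hα2 hw1 hw2 hA U gJ hInAk hInAx) hδw hRw hσw _ _) hG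

end Summit.QuantumFields.YangMills.Theorems.HalvingHStokesRowShell

end
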